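import Summits.KontsevichZagierPeriods.KontsevichZagierPeriods.Theorems.KzOnePeriodsE1DerivCMEngine

/-!
# E1 derivations, part 9: rows with coefficients in `ℚ(α)` — image points and the image period

Sub-problem `KzOnePeriods` (the theorem of Huber–Wüstholz [cite: HuberWustholz2022, Thm 13.3 (2)
p.121]); helper lane of the `E1` derivation modules; the engine is part 8
(`KzOnePeriodsE1DerivCMEngine`), the PIN relations part 7 (`KzOnePeriodsE1DerivCMUnits`).

`span_unit_rows_omega`: for a unit `α` of `Λ`, base logarithms `m_j` (rational points, the
real period), symbols `(E_L, ω, φ∘D_a)` with `D_a : t₀ ↝ t₀ + M_a`,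
`M_a = Σ_j p_aj m_j + Σ_j q_aj (αm_j)`, and coefficients `c_a ∈ ℚ̄` with
`Σ_a c_a (p_aj + α q_aj) = Σ_t λ_t n_tj` for integer relations `Σ_j n_tj m_j = 0`:
`Σ_a c_a (E_L, ω, φ∘D_a) ∈ ⟨(R1)–(R5)⟩_ℚ̄` — at every algebraic base point, for all lifts; the
constant of the engine vanishes by evaluating periods.  `span_unit_rows_eta`: the same for the
second-kind form `η = x dx/(2y)` (`β = α⁻¹`) with the explicit base-point constants of part 6
and the kz1p `ONE`-coefficient, computed by the same evaluation.
[cite: HuberWustholz2022, §13.1 (A)–(B) p.120, Thm 13.3 (2) p.121, §18.1 pp.160–161]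

No new axioms; no statements of the programme are cited.
-/

noncomputable section

open MvPolynomial Set Complex
open Literature.NumberTheory.Transcendental Literature.NumberTheory.Transcendental.CurvePeriods
open Literature.NumberTheory.Transcendental.CurvePeriods.Ell
open scoped PeriodPair

namespace Summit.KontsevichZagierPeriods.KzOnePeriods.E1LiftDerivation

/-- `c` lies in the `ℚ̄`-span of the elementary relations (R1)–(R5). -/
local notation3 "InSpanRel " c:arg => ∃ (k : ℕ) (ρ : Fin k → (PeriodSymbol →₀ ℂ))
  (a : Fin k → ℂ), (∀ l, IsElementaryRelation (ρ l)) ∧ (∀ l, IsAlgebraic ℚ (a l)) ∧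
    c = ∑ l, a l • ρ l

variable {L : PeriodPair} (h₂ : IsAlgebraic ℚ L.g₂) (h₃ : IsAlgebraic ℚ L.g₃)

local notation3 "S₀[" D "]" => LiftData.sym h₂ h₃ D (theta0 L) (hasAlgCoeffs_theta0 L h₂ h₃)
local notation3 "S₁[" D "]" => LiftData.sym h₂ h₃ D (theta1 L) (hasAlgCoeffs_theta1 L h₂ h₃)
local notation3 (prettyPrint := false) "Sω[" D "]" =>
  LiftData.sym h₂ h₃ D ((1 / 2 : ℂ) • theta0 L) (hasAlgCoeffs_half_theta0 h₂ h₃)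
local notation3 (prettyPrint := false) "Sη[" D "]" =>
  LiftData.sym h₂ h₃ D ((1 / 2 : ℂ) • theta1 L) (hasAlgCoeffs_half_theta1 h₂ h₃)
local notation3 "𝟙" => (Finsupp.single PeriodSymbol.unit (1 : ℂ) : PeriodSymbol →₀ ℂ)

/-! ## 4. Rows for `θ₀` and `ω = dx/(2y)` -/

include h₂ h₃ in
/-- **`ℚ(α)`-rows, form `θ₀`.**  With the data of the file header (`β = α`):
`Σ_a c_a (E_L, θ₀, φ∘D_a) ∈ ⟨(R1)–(R5)⟩_ℚ̄` at every algebraic base point, for all lifts.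
[cite: HuberWustholz2022, §13.1 (A)–(B) p.120, §18.1 pp.160–161] -/
theorem span_unit_rows_theta0 {α : ℂ} (hα : α ≠ 0) (hU : ∀ x, α * x ∈ L.lattice ↔ x ∈ L.lattice)
    {r : ℕ} (m : Fin r → ℂ) (hm : ∀ j, AlgLog L (m j))
    {R : ℕ} (M : Fin R → ℂ) (p q : Fin R → Fin r → ℤ)
    (hM : ∀ a, M a = ∑ j, ((p a j : ℂ) * m j + (q a j : ℂ) * (α * m j)))
    (c cα : Fin R → ℂ) (hc : ∀ a, IsAlgebraic ℚ (c a)) (hcα : ∀ a, cα a = c a * α)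
    {T : ℕ} (n : Fin T → Fin r → ℤ) (hn : ∀ t, ∑ j, (n t j : ℂ) * m j = 0)
    (lam : Fin T → ℂ) (hlam : ∀ t, IsAlgebraic ℚ (lam t))
    (hcoef : ∀ j, ∑ a, (c a * (p a j : ℂ) + cα a * (q a j : ℂ)) = ∑ t, lam t * (n t j : ℂ))
    {t₀ : ℂ} (ht₀ : IsAlgPt L t₀) (D : ∀ a, LiftData L t₀ (t₀ + M a)) :
    InSpanRel (∑ a, c a • S₀[D a]) := by
  obtain ⟨κ, -, h⟩ := spanC_unit_rows h₂ h₃ (theta0 L) (hasAlgCoeffs_theta0 L h₂ h₃)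
    (fun hv D D' ha hb => spanC_of_span (LiftData.span_translate_theta0 h₂ h₃ hv D D' ha hb))
    (fun m hm n hs _ ht₀ D => spanC_of_span (span_zsum_theta0 h₂ h₃ m hm n hs ht₀ D))
    hα hU (fun hm ht₀ D D' => spanC_of_span (span_unit_theta0 h₂ h₃ hα hU hm ht₀ D D'))
    m hm M p q hM c cα hc hcα n hn lam hlam hcoef ht₀ D
  have hnum : ∑ a, c a * M a + 0 = 0 :=
    unit_rows_numbers m M α p q hM c cα hcα n (fun _ => 0) (fun t => by rw [add_zero, hn t]) lam
      hcoef (by simp)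
  have h0 := G0Derivation.evalCombination_eq_zero_of_span h
  rw [evalCombination_sub, evalCombination_smul, evalCombination_single, period_unit,
    evalCombination_finsetSum] at h0
  simp only [evalCombination_smul, LiftData.evalCombination_sym_theta0 h₂ h₃,
    add_sub_cancel_left] at h0
  have h2 : ∑ a, c a * (2 * M a) = 2 * ∑ a, c a * M a := by
    rw [Finset.mul_sum]; exact Finset.sum_congr rfl fun a _ => by ring
  rw [add_zero] at hnum
  rw [h2, hnum] at h0
  have hκ : κ = 0 := by linear_combination -h0
  rwa [hκ, zero_smul, sub_zero] at h

include h₂ h₃ in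
/-- **`ℚ(α)`-rows, kz1p's form `ω = dx/(2y)`.** [cite: HuberWustholz2022, §13.1 (A)–(B) p.120,
Thm 13.3 (2) p.121, §18.1 pp.160–161] -/
theorem span_unit_rows_omega {α : ℂ} (hα : α ≠ 0) (hU : ∀ x, α * x ∈ L.lattice ↔ x ∈ L.lattice)
    {r : ℕ} (m : Fin r → ℂ) (hm : ∀ j, AlgLog L (m j))
    {R : ℕ} (M : Fin R → ℂ) (p q : Fin R → Fin r → ℤ)
    (hM : ∀ a, M a = ∑ j, ((p a j : ℂ) * m j + (q a j : ℂ) * (α * m j)))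
    (c cα : Fin R → ℂ) (hc : ∀ a, IsAlgebraic ℚ (c a)) (hcα : ∀ a, cα a = c a * α)
    {T : ℕ} (n : Fin T → Fin r → ℤ) (hn : ∀ t, ∑ j, (n t j : ℂ) * m j = 0)
    (lam : Fin T → ℂ) (hlam : ∀ t, IsAlgebraic ℚ (lam t))
    (hcoef : ∀ j, ∑ a, (c a * (p a j : ℂ) + cα a * (q a j : ℂ)) = ∑ t, lam t * (n t j : ℂ))
    {t₀ : ℂ} (ht₀ : IsAlgPt L t₀) (D : ∀ a, LiftData L t₀ (t₀ + M a)) :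
    InSpanRel (∑ a, c a • Sω[D a]) := by
  have h : IsAlgebraic ℚ (1 / 2 : ℂ) := by rw [one_div]; exact (isAlgebraic_nat 2).inv
  have h1 : InSpanRel (∑ a, c a • (Sω[D a] - (1 / 2 : ℂ) • S₀[D a])) :=
    CurvePeriods.span_finsetSum _ _ fun a _ => CurvePeriods.span_smul (hc a)
      (span_sym_omega_sub h₂ h₃ (D a))
  have h2 : InSpanRel ((1 / 2 : ℂ) • ∑ a, c a • S₀[D a]) :=
    CurvePeriods.span_smul h (span_unit_rows_theta0 h₂ h₃ hα hU m hm M p q hM c cα hc hcα n hn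
      lam hlam hcoef ht₀ D)
  have e : ∑ a, c a • Sω[D a] =
      ∑ a, c a • (Sω[D a] - (1 / 2 : ℂ) • S₀[D a]) + (1 / 2 : ℂ) • ∑ a, c a • S₀[D a] := by
    rw [Finset.smul_sum, ← Finset.sum_add_distrib]
    exact Finset.sum_congr rfl fun a _ => by rw [smul_sub, smul_comm, sub_add_cancel]
  rw [e]
  exact CurvePeriods.span_add h1 h2

/-! ## 5. Rows for `θ₁` and `η = x dx/(2y)` -/

include h₂ h₃ in
/-- **`ℚ(α)`-rows, form `θ₁`** (`β = α⁻¹`): `Σ_a c_a (E_L, θ₁, φ∘D_a) ≡ κ · 𝟙` modulo the span, for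
an algebraic constant `κ`. [cite: HuberWustholz2022, §13.1 (A)–(B) p.120, §18.1 pp.160–161] -/
theorem span_unit_rows_theta1 {α : ℂ} (hα : α ≠ 0) (hU : ∀ x, α * x ∈ L.lattice ↔ x ∈ L.lattice)
    {r : ℕ} (m : Fin r → ℂ) (hm : ∀ j, AlgLog L (m j))
    {R : ℕ} (M : Fin R → ℂ) (p q : Fin R → Fin r → ℤ)
    (hM : ∀ a, M a = ∑ j, ((p a j : ℂ) * m j + (q a j : ℂ) * (α * m j)))
    (c cβ : Fin R → ℂ) (hc : ∀ a, IsAlgebraic ℚ (c a)) (hcβ : ∀ a, cβ a = c a * α⁻¹)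
    {T : ℕ} (n : Fin T → Fin r → ℤ) (hn : ∀ t, ∑ j, (n t j : ℂ) * m j = 0)
    (μ : Fin T → ℂ) (hμ : ∀ t, IsAlgebraic ℚ (μ t))
    (hcoef : ∀ j, ∑ a, (c a * (p a j : ℂ) + cβ a * (q a j : ℂ)) = ∑ t, μ t * (n t j : ℂ))
    {t₀ : ℂ} (ht₀ : IsAlgPt L t₀) (D : ∀ a, LiftData L t₀ (t₀ + M a)) :
    ∃ κ : ℂ, IsAlgebraic ℚ κ ∧ InSpanRel (∑ a, c a • S₁[D a] - κ • 𝟙) :=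
  spanC_unit_rows h₂ h₃ (theta1 L) (hasAlgCoeffs_theta1 L h₂ h₃)
    (fun hv D D' ha hb => ⟨_, isAlgebraic_translate_const L hv D.alg_start D.alg_stop,
      LiftData.span_translate_theta1 h₂ h₃ hv D D' ha hb⟩)
    (fun m hm n hs _ ht₀ D => span_zsum_theta1 h₂ h₃ m hm n hs ht₀ D)
    hα hU (fun hm ht₀ D D' => span_unit_theta1 h₂ h₃ hα hU hm ht₀ D D')
    m hm M p q hM c cβ hc hcβ n hn μ hμ hcoef ht₀ D

include h₂ h₃ in
/-- **`ℚ(α)`-rows, kz1p's second-kind form `η = x dx/(2y)`, with explicit constants.**  With the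
data of the file header (`β = α⁻¹`), the base-point dictionary `ζ(t₀ + M_a) − ζ(t₀) = z_a + e_a`
(`z_a` the kz1p value of the symbol, `e_a` the algebraic base-point constant, parts 6–7) and a
numerical identity `Σ_a c_a z_a + k = 0` (`unit_rows_numbers`), the kz1p row
`Σ_a c_a ((E_L, η, φ∘D_a) + e_a·𝟙) − k·𝟙` lies in `⟨(R1)–(R5)⟩_ℚ̄`.
[cite: HuberWustholz2022, §13.1 (A)–(B) p.120, Thm 13.3 (2) p.121, §18.1 pp.160–161] -/
theorem span_unit_rows_eta {α : ℂ} (hα : α ≠ 0) (hU : ∀ x, α * x ∈ L.lattice ↔ x ∈ L.lattice)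
    {r : ℕ} (m : Fin r → ℂ) (hm : ∀ j, AlgLog L (m j))
    {R : ℕ} (M : Fin R → ℂ) (p q : Fin R → Fin r → ℤ)
    (hM : ∀ a, M a = ∑ j, ((p a j : ℂ) * m j + (q a j : ℂ) * (α * m j)))
    (c cβ : Fin R → ℂ) (hc : ∀ a, IsAlgebraic ℚ (c a)) (hcβ : ∀ a, cβ a = c a * α⁻¹)
    {T : ℕ} (n : Fin T → Fin r → ℤ) (hn : ∀ t, ∑ j, (n t j : ℂ) * m j = 0)
    (μ : Fin T → ℂ) (hμ : ∀ t, IsAlgebraic ℚ (μ t))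
    (hcoef : ∀ j, ∑ a, (c a * (p a j : ℂ) + cβ a * (q a j : ℂ)) = ∑ t, μ t * (n t j : ℂ))
    {t₀ : ℂ} (ht₀ : IsAlgPt L t₀) (D : ∀ a, LiftData L t₀ (t₀ + M a)) (e z : Fin R → ℂ)
    (hz : ∀ a, L.weierstrassZeta (t₀ + M a) - L.weierstrassZeta t₀ = z a + e a)
    (k : ℂ) (hrow : ∑ a, c a * z a + k = 0) :
    InSpanRel (∑ a, c a • (Sη[D a] + e a • 𝟙) - k • 𝟙) := by
  have hhalf : IsAlgebraic ℚ (1 / 2 : ℂ) := by rw [one_div]; exact (isAlgebraic_nat 2).inv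
  obtain ⟨κ, -, h1⟩ := span_unit_rows_theta1 h₂ h₃ hα hU m hm M p q hM c cβ hc hcβ n hn μ hμ hcoef
    ht₀ D
  have h2 : InSpanRel (∑ a, c a • (Sη[D a] - (1 / 2 : ℂ) • S₁[D a])) :=
    CurvePeriods.span_finsetSum _ _ fun a _ => CurvePeriods.span_smul (hc a)
      (span_sym_eta_sub h₂ h₃ (D a))
  have h3 : InSpanRel (∑ a, c a • Sη[D a] - (κ / 2) • 𝟙) := by
    have h := CurvePeriods.span_add h2 (CurvePeriods.span_smul hhalf h1)
    have e1 : ∑ a, c a • (Sη[D a] - (1 / 2 : ℂ) • S₁[D a]) +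
        (1 / 2 : ℂ) • (∑ a, c a • S₁[D a] - κ • 𝟙) = ∑ a, c a • Sη[D a] - (κ / 2) • 𝟙 := by
      have ec : ∀ a, c a • ((1 / 2 : ℂ) • S₁[D a]) = (1 / 2 : ℂ) • (c a • S₁[D a]) :=
        fun a => smul_comm _ _ _
      simp only [smul_sub, Finset.sum_sub_distrib, Finset.smul_sum, ec, smul_smul,
        show (1 / 2 : ℂ) * κ = κ / 2 by ring]
      abel
    rwa [e1] at h
  have hX0 := G0Derivation.evalCombination_eq_zero_of_span h3
  have hev : evalCombination (∑ a, c a • Sη[D a] - (κ / 2) • 𝟙) =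
      -(∑ a, c a * z a + k) + (k - ∑ a, c a * e a) - κ / 2 := by
    rw [evalCombination_sub, evalCombination_smul, evalCombination_single, period_unit,
      evalCombination_finsetSum]
    simp only [evalCombination_smul, evalCombination_sym_eta h₂ h₃, hz, mul_neg, mul_add,
      Finset.sum_neg_distrib, Finset.sum_add_distrib]
    ring
  rw [hev, hrow] at hX0
  have hc2 : κ / 2 = k - ∑ a, c a * e a := by linear_combination -hX0
  have e2 : ∑ a, c a • (Sη[D a] + e a • 𝟙) - k • 𝟙 = ∑ a, c a • Sη[D a] - (κ / 2) • 𝟙 := by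
    rw [hc2]
    simp only [smul_add, Finset.sum_add_distrib, smul_smul, sub_smul, Finset.sum_smul]
    abel
  rw [e2]
  exact h3

/-! ## 6. `K = ℚ(i)`: Gaussian coefficient vectors (`α = i`, curves with `iΛ = Λ`, e.g. `g₃ = 0`) -/

/-- `x + yi` is algebraic for `x, y ∈ ℚ`. [folklore] -/
theorem isAlgebraic_gauss (x y : ℚ) : IsAlgebraic ℚ ((x : ℂ) + (y : ℂ) * I) :=
  isAlgebraic_of_eq_gauss x y rfl

/-- Real/imaginary splitting of `Σ_a ((x_a + y_a i) u_a + (x_a + y_a i) i v_a)`. [folklore] -/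
theorem gauss_coef_split {R T : ℕ} (x y : Fin R → ℚ) (u v : Fin R → ℤ) (lre lim : Fin T → ℚ)
    (w : Fin T → ℤ) (hre : ∑ a, (x a * u a - y a * v a) = ∑ t, lre t * w t)
    (him : ∑ a, (y a * u a + x a * v a) = ∑ t, lim t * w t) :
    ∑ a, (((x a : ℂ) + (y a : ℂ) * I) * (u a : ℂ) + (-(y a : ℂ) + (x a : ℂ) * I) * (v a : ℂ)) =
      ∑ t, ((lre t : ℂ) + (lim t : ℂ) * I) * (w t : ℂ) := by
  have e1 := congrArg (fun q : ℚ => (q : ℂ)) hre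
  have e2 := congrArg (fun q : ℚ => (q : ℂ)) him
  push_cast at e1 e2
  have eL :
      ∑ a, (((x a : ℂ) + (y a : ℂ) * I) * (u a : ℂ) + (-(y a : ℂ) + (x a : ℂ) * I) * (v a : ℂ)) =
      ∑ a, ((x a : ℂ) * (u a : ℂ) - (y a : ℂ) * (v a : ℂ)) +
        I * ∑ a, ((y a : ℂ) * (u a : ℂ) + (x a : ℂ) * (v a : ℂ)) := by
    rw [Finset.mul_sum, ← Finset.sum_add_distrib]
    exact Finset.sum_congr rfl fun a _ => by ring
  have eR : ∑ t, ((lre t : ℂ) + (lim t : ℂ) * I) * (w t : ℂ) =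
      ∑ t, (lre t : ℂ) * (w t : ℂ) + I * ∑ t, (lim t : ℂ) * (w t : ℂ) := by
    rw [Finset.mul_sum, ← Finset.sum_add_distrib]
    exact Finset.sum_congr rfl fun t _ => by ring
  rw [eL, eR]
  linear_combination e1 + I * e2

/-- Real/imaginary splitting of `Σ_a ((x_a + y_a i) u_a + (x_a + y_a i) i⁻¹ v_a)`. [folklore] -/
theorem gauss_coef_split' {R T : ℕ} (x y : Fin R → ℚ) (u v : Fin R → ℤ) (lre lim : Fin T → ℚ)
    (w : Fin T → ℤ) (hre : ∑ a, (x a * u a + y a * v a) = ∑ t, lre t * w t)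
    (him : ∑ a, (y a * u a - x a * v a) = ∑ t, lim t * w t) :
    ∑ a, (((x a : ℂ) + (y a : ℂ) * I) * (u a : ℂ) + ((y a : ℂ) - (x a : ℂ) * I) * (v a : ℂ)) =
      ∑ t, ((lre t : ℂ) + (lim t : ℂ) * I) * (w t : ℂ) := by
  have e1 := congrArg (fun q : ℚ => (q : ℂ)) hre
  have e2 := congrArg (fun q : ℚ => (q : ℂ)) him
  push_cast at e1 e2
  have eL : ∑ a, (((x a : ℂ) + (y a : ℂ) * I) * (u a : ℂ) + ((y a : ℂ) - (x a : ℂ) * I) * (v a : ℂ))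
      = ∑ a, ((x a : ℂ) * (u a : ℂ) + (y a : ℂ) * (v a : ℂ)) +
        I * ∑ a, ((y a : ℂ) * (u a : ℂ) - (x a : ℂ) * (v a : ℂ)) := by
    rw [Finset.mul_sum, ← Finset.sum_add_distrib]
    exact Finset.sum_congr rfl fun a _ => by ring
  have eR : ∑ t, ((lre t : ℂ) + (lim t : ℂ) * I) * (w t : ℂ) =
      ∑ t, (lre t : ℂ) * (w t : ℂ) + I * ∑ t, (lim t : ℂ) * (w t : ℂ) := by
    rw [Finset.mul_sum, ← Finset.sum_add_distrib]
    exact Finset.sum_congr rfl fun t _ => by ring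
  rw [eL, eR]
  linear_combination e1 + I * e2

/-- **Row numbers over `ℚ(i)`** (`γ = i⁻¹ = −i`): cf. `unit_rows_numbers`. [folklore] -/
theorem gauss_rows_numbers {r R T : ℕ} (xv : Fin r → ℂ) (X : Fin R → ℂ)
    (p q : Fin R → Fin r → ℤ)
    (hX : ∀ a, X a = ∑ j, ((p a j : ℂ) * xv j + (q a j : ℂ) * (-I * xv j)))
    (x y : Fin R → ℚ) (n : Fin T → Fin r → ℤ) (kt : Fin T → ℂ)
    (hrows : ∀ t, ∑ j, (n t j : ℂ) * xv j + kt t = 0) (lre lim : Fin T → ℚ)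
    (hre : ∀ j, ∑ a, (x a * p a j + y a * q a j) = ∑ t, lre t * n t j)
    (him : ∀ j, ∑ a, (y a * p a j - x a * q a j) = ∑ t, lim t * n t j)
    {k : ℂ} (hk : ∑ t, ((lre t : ℂ) + (lim t : ℂ) * I) * kt t = k) :
    ∑ a, ((x a : ℂ) + (y a : ℂ) * I) * X a + k = 0 :=
  unit_rows_numbers xv X (-I) p q hX _ (fun a => (y a : ℂ) - (x a : ℂ) * I)
    (fun a => by linear_combination (y a : ℂ) * I_sq) n kt hrows _
    (fun j => gauss_coef_split' x y (fun a => p a j) (fun a => q a j) lre lim (fun t => n t j)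
      (hre j) (him j)) hk

include h₂ h₃ in
/-- **`ℚ(i)`-rows, form `ω = dx/(2y)`** on a curve with `iΛ = Λ`: the row
`Σ_a (x_a + y_a i)·Sω[D_a]` (symbols at rational points, their `[i]`-images, `Ω₁`, `iΩ₁`) lies in
`⟨(R1)–(R5)⟩_ℚ̄`, given integer relations `n_t` among the base logarithms and the exact
`ℚ`-identities `hre`, `him` of coefficient vectors (real and imaginary part of
`Σ_a c_a (p_a + i q_a) = Σ_t λ_t n_t`).
[cite: HuberWustholz2022, §13.1 (A)–(B) p.120, Thm 13.3 (2) p.121, §18.1 pp.160–161] -/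
theorem span_gauss_rows_omega (hU : ∀ x, I * x ∈ L.lattice ↔ x ∈ L.lattice)
    {r : ℕ} (m : Fin r → ℂ) (hm : ∀ j, AlgLog L (m j))
    {R : ℕ} (M : Fin R → ℂ) (p q : Fin R → Fin r → ℤ)
    (hM : ∀ a, M a = ∑ j, ((p a j : ℂ) * m j + (q a j : ℂ) * (I * m j)))
    (x y : Fin R → ℚ) {T : ℕ} (n : Fin T → Fin r → ℤ) (hn : ∀ t, ∑ j, (n t j : ℂ) * m j = 0)
    (lre lim : Fin T → ℚ)
    (hre : ∀ j, ∑ a, (x a * p a j - y a * q a j) = ∑ t, lre t * n t j)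
    (him : ∀ j, ∑ a, (y a * p a j + x a * q a j) = ∑ t, lim t * n t j)
    {t₀ : ℂ} (ht₀ : IsAlgPt L t₀) (D : ∀ a, LiftData L t₀ (t₀ + M a)) :
    InSpanRel (∑ a, ((x a : ℂ) + (y a : ℂ) * I) • Sω[D a]) :=
  span_unit_rows_omega h₂ h₃ I_ne_zero hU m hm M p q hM _ (fun a => -(y a : ℂ) + (x a : ℂ) * I)
    (fun a => isAlgebraic_gauss (x a) (y a))
    (fun a => by linear_combination (-(y a : ℂ)) * I_sq) n hn
    (fun t => (lre t : ℂ) + (lim t : ℂ) * I) (fun t => isAlgebraic_gauss (lre t) (lim t))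
    (fun j => gauss_coef_split x y (fun a => p a j) (fun a => q a j) lre lim (fun t => n t j)
      (hre j) (him j)) ht₀ D

include h₂ h₃ in
/-- **`ℚ(i)`-rows, form `η = x dx/(2y)`** (`β = i⁻¹`), with the explicit constants `e_a`, `k` as in
`span_unit_rows_eta`. [cite: HuberWustholz2022, §13.1 (A)–(B) p.120, Thm 13.3 (2) p.121,
§18.1 pp.160–161] -/
theorem span_gauss_rows_eta (hU : ∀ x, I * x ∈ L.lattice ↔ x ∈ L.lattice)
    {r : ℕ} (m : Fin r → ℂ) (hm : ∀ j, AlgLog L (m j))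
    {R : ℕ} (M : Fin R → ℂ) (p q : Fin R → Fin r → ℤ)
    (hM : ∀ a, M a = ∑ j, ((p a j : ℂ) * m j + (q a j : ℂ) * (I * m j)))
    (x y : Fin R → ℚ) {T : ℕ} (n : Fin T → Fin r → ℤ) (hn : ∀ t, ∑ j, (n t j : ℂ) * m j = 0)
    (lre lim : Fin T → ℚ)
    (hre : ∀ j, ∑ a, (x a * p a j + y a * q a j) = ∑ t, lre t * n t j)
    (him : ∀ j, ∑ a, (y a * p a j - x a * q a j) = ∑ t, lim t * n t j)
    {t₀ : ℂ} (ht₀ : IsAlgPt L t₀) (D : ∀ a, LiftData L t₀ (t₀ + M a)) (e z : Fin R → ℂ)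
    (hz : ∀ a, L.weierstrassZeta (t₀ + M a) - L.weierstrassZeta t₀ = z a + e a)
    (k : ℂ) (hrow : ∑ a, ((x a : ℂ) + (y a : ℂ) * I) * z a + k = 0) :
    InSpanRel (∑ a, ((x a : ℂ) + (y a : ℂ) * I) • (Sη[D a] + e a • 𝟙) - k • 𝟙) :=
  span_unit_rows_eta h₂ h₃ I_ne_zero hU m hm M p q hM _ (fun a => (y a : ℂ) - (x a : ℂ) * I)
    (fun a => isAlgebraic_gauss (x a) (y a))
    (fun a => by rw [inv_I]; linear_combination (y a : ℂ) * I_sq) n hn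
    (fun t => (lre t : ℂ) + (lim t : ℂ) * I) (fun t => isAlgebraic_gauss (lre t) (lim t))
    (fun j => gauss_coef_split' x y (fun a => p a j) (fun a => q a j) lre lim (fun t => n t j)
      (hre j) (him j)) ht₀ D e z hz k hrow

/-- **The base-point dictionary at an image point**: `ζ(t₀ + iu) − ζ(t₀) = −iζ(u) + e` with the
base-point constant of the image point `[i]φ(u) = (−x, iy)`.
[cite: ArmitageEberlein2001, §7.4.2 (7.66)] -/
theorem zeta_base_point_I (hU : ∀ x, I * x ∈ L.lattice ↔ x ∈ L.lattice) {t₀ u x y : ℂ}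
    (ht : t₀ ∉ L.lattice) (hu : u ∉ L.lattice) (hX : phi L u = ![x, y])
    (hne : ℘[L] t₀ ≠ -x) : L.weierstrassZeta (t₀ + I * u) - L.weierstrassZeta t₀ =
      -I * L.weierstrassZeta u + (℘'[L] t₀ / 2 - I * y) / (℘[L] t₀ - -x) := by
  rw [← weierstrassZeta_I_mul hU]
  exact zeta_base_point ht ((unit_mul_notMem_iff hU).2 hu) (phi_I_mul hU hX) hne

end Summit.KontsevichZagierPeriods.KzOnePeriods.E1LiftDerivation

end
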